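import Summits.ABC.StewartYu.PadicG3ParVB
import Summits.ABC.StewartYu.PadicG3ParC
import HarnessLib

/-!
# The `p`-adic Gen-3 parameter record v2 (corrected family `…V`) — part VF: the box and the Siegel count (B1)

Support file (one closed form + plain theorems; no named facts). Twin of `PadicG3ParC` for the R1′ family:
the box half-sides **`sideV j = ⌊LV/(2 A j)⌋`** (v1 convention — with `⌊LV/(4Aⱼ)⌋` the count below loses `2ⁿ`
and fails analytically for `n ≥ 3`), `(3/4)ⁿ LVⁿ/Ω ≤ ∏(2 sideV j + 1)`, and **the START count**
`2·(2·XsV 0 + 1)·C(M′+n, n)·K ≤ (L₀V + 1)·∏(2 sideV j + 1)` for every order bound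
`M′ + n ≤ (69/4)(n+1)·LgV` (which covers `MordV 0 0 + (n+1)(ŜG+1) + n`, `MordV_T0_le`): unknowns
`≥ 6 XV K (24e)ⁿ LVⁿ/g^{n−1} ≥ 6 g XV K (24e(LgV−1))ⁿ` (as `LV ≥ g(LgV − 1)`), equations
`≤ (2gXV+6) K ((69/4) e LgV)ⁿ ≤ 6 g XV K (24e(LgV−1))ⁿ` (as `24(LgV−1) ≥ (69/4)LgV`). The level-0 range is
`XsV 0 ≍ g XV/2` — the reason for R1′ (plan g8 2026-08-27T03:09:52Z).

## References
* [Nesterenko2003] Yu. V. Nesterenko, LNM 1819 (2003) — Prop 3.4, Prop 3.9 (3.48).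
* [Yu2013] K. Yu, Acta Math. 211 (2013) — §3.1 (3.7).
-/

noncomputable section

open Finset Real

namespace Summit.ABC.StewartYu

namespace PadicG3Par

variable {n : ℕ} (P : PadicG3Par n)

/-! ### The box -/

/-- the v2 box half-sides `sideV j = ⌊LV/(2 A j)⌋₊`. [cite: Nesterenko2003, (3.12)] -/
def sideV (j : Fin n) : ℕ := ⌊(P.LV : ℝ) / (2 * P.A j)⌋₊

/-- `sideV j ≤ LV/(2 A j)`. [folklore] -/
theorem sideV_le (j : Fin n) : (P.sideV j : ℝ) ≤ P.LV / (2 * P.A j) :=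
  Nat.floor_le (by have := P.A_pos j; have := P.one_le_LV; positivity)

/-- `1 ≤ LV/(2 A j)`. [folklore] -/
theorem one_le_LV_div (j : Fin n) : (1 : ℝ) ≤ P.LV / (2 * P.A j) := by
  have hA := P.A_pos j
  rw [le_div_iff₀ (by positivity)]
  have := P.hAmax j; have := P.two_Amax_le_LV
  linarith

/-- `1 ≤ sideV j`. [folklore] -/
theorem one_le_sideV (j : Fin n) : 1 ≤ P.sideV j := by
  unfold sideV; exact Nat.le_floor (by exact_mod_cast P.one_le_LV_div j)

/-- `(3/4) · LV/A j ≤ 2 sideV j + 1`. [folklore] -/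
theorem three_quarters_leV (j : Fin n) : (3 / 4 : ℝ) * (P.LV / P.A j) ≤ 2 * (P.sideV j : ℝ) + 1 := by
  have hA := P.A_pos j
  have hy := P.one_le_LV_div j
  have hk : (1 : ℝ) ≤ P.sideV j := by exact_mod_cast P.one_le_sideV j
  have hlt : (P.LV : ℝ) / (2 * P.A j) < P.sideV j + 1 := by unfold sideV; exact Nat.lt_floor_add_one _
  have e : (P.LV : ℝ) / P.A j = 2 * (P.LV / (2 * P.A j)) := by field_simp
  rw [e]
  nlinarith

/-- **`(3/4)ⁿ · LVⁿ/Ω ≤ ∏ (2 sideV j + 1)`**. [cite: Nesterenko2003, Prop 3.4] -/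
theorem prod_sideV_ge : (3 / 4 : ℝ) ^ n * ((P.LV : ℝ) ^ n / P.Ω) ≤ ∏ j, (2 * (P.sideV j : ℝ) + 1) := by
  have e : (3 / 4 : ℝ) ^ n * ((P.LV : ℝ) ^ n / P.Ω) = ∏ j : Fin n, (3 / 4 : ℝ) * (P.LV / P.A j) := by
    rw [prod_mul_distrib, prod_const, card_univ, Fintype.card_fin, prod_div_distrib, prod_const,
      card_univ, Fintype.card_fin]
    rfl
  rw [e]
  exact prod_le_prod (fun j _ => by have := P.A_pos j; have := P.one_le_LV; positivity)
    fun j _ => P.three_quarters_leV j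

/-- the exponent heights of the box: `∑ sideV j · A j ≤ n · LV/2`. [folklore] -/
theorem sum_sideV_mul_le : ∑ j, (P.sideV j : ℝ) * P.A j ≤ n * P.LV / 2 := by
  have h : ∀ j ∈ (univ : Finset (Fin n)), (P.sideV j : ℝ) * P.A j ≤ P.LV / 2 := by
    intro j _
    have hA := P.A_pos j
    have := P.sideV_le j
    rw [le_div_iff₀ (by positivity)] at this
    linarith
  calc ∑ j, (P.sideV j : ℝ) * P.A j ≤ ∑ _j : Fin n, (P.LV : ℝ) / 2 := sum_le_sum h
    _ = n * P.LV / 2 := by rw [sum_const, card_univ, Fintype.card_fin]; simp [nsmul_eq_mul]; ring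

/-! ### The Siegel count (B1) -/

/-- the order bound of the level-0 START: `MordV 0 0 + (n+1)(ŜG+1) + n ≤ (69/4)(n+1) LgV`. [folklore] -/
theorem MordV_T0_le : (P.MordV 0 0 : ℝ) + (n + 1) * (P.SdG + 1) + n ≤ (69 / 4) * (n + 1) * P.LgV := by
  have h1 := P.MordV_zero_zero_add_le
  have h4 : ((4 * (P.SdG + 2) : ℕ) : ℝ) ≤ P.LgV := by exact_mod_cast P.four_SdG_le_LgV
  push_cast at h4
  have hn : (0 : ℝ) ≤ n := by positivity
  nlinarith

/-- `2 (2 XsV 0 + 1) ≤ 6 g XV` (`XsV 0 ≤ g XV/2 + 1`, `g XV ≥ 128`). [folklore] -/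
theorem eqs_range_le : 2 * (2 * (P.XsV 0 : ℝ) + 1) ≤ 6 * (P.g * P.XV) := by
  have h := P.XsV_le 0
  simp only [pow_zero, one_mul] at h
  have hg := P.one_le_g
  have hX := P.XV_ge_128
  have hgX : (128 : ℝ) ≤ P.g * P.XV := by nlinarith
  linarith

/-- `g · (LgV − 1) ≤ LV` (real). [folklore] -/
theorem g_mul_LgV_sub_one_le_LV : P.g * ((P.LgV : ℝ) - 1) ≤ P.LV := by
  have h := P.LV_gt
  have hg := P.one_le_g
  nlinarith

/-- **(B1) THE v2 SIEGEL COUNT** (real form): for every order bound `M′ + n ≤ (69/4)(n+1)LgV`,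
`2·(2·XsV 0 + 1)·C(M′+n, n)·K ≤ (L₀V + 1)·∏ (2 sideV j + 1)`. [cite: Nesterenko2003, Prop 3.9 (3.48)] -/
theorem siegel_countV_real {M' : ℕ} (hM : (M' : ℝ) + n ≤ (69 / 4) * (n + 1) * P.LgV) :
    2 * (2 * (P.XsV 0 : ℝ) + 1) * (Nat.choose (M' + n) n : ℝ) * P.K ≤
      ((P.L0V : ℝ) + 1) * ∏ j, (2 * (P.sideV j : ℝ) + 1) := by
  have hLg1 := P.one_le_LgV
  have hLg4 : (4 : ℝ) ≤ P.LgV := by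
    have h1 : 4 ≤ 2 ^ (n + 25) := le_trans (by norm_num) (Nat.pow_le_pow_right (by norm_num) (show 2 ≤ n + 25 by omega))
    exact_mod_cast h1.trans P.two_pow_le_LgV
  have hC : (Nat.choose (M' + n) n : ℝ) ≤ ((69 / 4) * P.LgV * Real.exp 1) ^ n :=
    choose_le_of_le M' (by positivity) (by linarith)
  have hprod := P.prod_sideV_ge
  have hL₀ := P.L0V_ge
  have hK := P.K_pos
  have hΩ := P.Ω_pos
  have hg1 := P.one_le_g
  have hg0 : 0 < P.g := by linarith
  have hgn : 0 < P.g ^ (n - 1) := pow_pos hg0 _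
  have hX : (0 : ℝ) ≤ P.XV := by positivity
  have he : (0 : ℝ) ≤ Real.exp 1 := (Real.exp_pos 1).le
  have hCb : (0 : ℝ) < Cb := Cb_pos
  have hLV := P.g_mul_LgV_sub_one_le_LV
  have hLV0 : (0 : ℝ) ≤ P.g * ((P.LgV : ℝ) - 1) := by nlinarith
  -- (1) unknowns ≥ `6 XV K (24 e)ⁿ LVⁿ / g^{n-1}`
  have e2 : Cb * (3 / 4) = 24 * Real.exp 1 := by unfold Cb cM; push_cast; ring
  have hR : 6 * P.XV * P.K * (24 * Real.exp 1) ^ n * (P.LV : ℝ) ^ n / P.g ^ (n - 1) ≤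
      ((P.L0V : ℝ) + 1) * ∏ j, (2 * (P.sideV j : ℝ) + 1) := by
    have e : 6 * P.XV * Cb ^ n * P.Ω * P.K / P.g ^ (n - 1) * ((3 / 4 : ℝ) ^ n * ((P.LV : ℝ) ^ n / P.Ω)) =
        6 * P.XV * P.K * (24 * Real.exp 1) ^ n * (P.LV : ℝ) ^ n / P.g ^ (n - 1) := by
      rw [← e2, mul_pow]
      field_simp
    rw [← e]
    have h0 : 0 ≤ 6 * P.XV * Cb ^ n * P.Ω * P.K / P.g ^ (n - 1) := by positivity
    calc 6 * P.XV * Cb ^ n * P.Ω * P.K / P.g ^ (n - 1) * ((3 / 4 : ℝ) ^ n * ((P.LV : ℝ) ^ n / P.Ω))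
        ≤ (P.L0V : ℝ) * ∏ j, (2 * (P.sideV j : ℝ) + 1) :=
          mul_le_mul hL₀ hprod (by positivity) (by positivity)
      _ ≤ ((P.L0V : ℝ) + 1) * ∏ j, (2 * (P.sideV j : ℝ) + 1) := by
          have : 0 ≤ ∏ j, (2 * (P.sideV j : ℝ) + 1) := prod_nonneg fun j _ => by positivity
          nlinarith
  -- (2) `g (LgV - 1)ⁿ ≤ LVⁿ/g^{n-1}` (as `(g (LgV-1))ⁿ ≤ LVⁿ` and `gⁿ = g^{n-1} g`)
  have hpow : P.g * ((P.LgV : ℝ) - 1) ^ n ≤ (P.LV : ℝ) ^ n / P.g ^ (n - 1) := by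
    have h1 : (P.g * ((P.LgV : ℝ) - 1)) ^ n ≤ (P.LV : ℝ) ^ n := pow_le_pow_left₀ hLV0 hLV n
    rw [le_div_iff₀ hgn]
    have e4 : P.g * ((P.LgV : ℝ) - 1) ^ n * P.g ^ (n - 1) = (P.g * ((P.LgV : ℝ) - 1)) ^ n := by
      rw [mul_pow, P.pow_g_eq]; ring
    rw [e4]; exact h1
  -- (3) `(69/4) e LgV ≤ 24 e (LgV - 1)` (as `LgV ≥ 4`)
  have hbase : (69 / 4) * (P.LgV : ℝ) * Real.exp 1 ≤ 24 * Real.exp 1 * ((P.LgV : ℝ) - 1) := by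
    nlinarith [Real.exp_pos 1]
  have hbase0 : 0 ≤ (69 / 4) * (P.LgV : ℝ) * Real.exp 1 := by positivity
  have hpown : ((69 / 4) * (P.LgV : ℝ) * Real.exp 1) ^ n ≤ (24 * Real.exp 1 * ((P.LgV : ℝ) - 1)) ^ n :=
    pow_le_pow_left₀ hbase0 hbase n
  -- (4) assemble
  have hrange := P.eqs_range_le
  have hCpos : (0 : ℝ) ≤ (Nat.choose (M' + n) n : ℝ) := by positivity
  have hXs0 : (0 : ℝ) ≤ 2 * (2 * (P.XsV 0 : ℝ) + 1) := by positivity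
  calc 2 * (2 * (P.XsV 0 : ℝ) + 1) * (Nat.choose (M' + n) n : ℝ) * P.K
      ≤ (6 * (P.g * P.XV)) * ((69 / 4) * (P.LgV : ℝ) * Real.exp 1) ^ n * P.K := by
        gcongr
    _ ≤ (6 * (P.g * P.XV)) * (24 * Real.exp 1 * ((P.LgV : ℝ) - 1)) ^ n * P.K := by gcongr
    _ = 6 * P.XV * P.K * (24 * Real.exp 1) ^ n * (P.g * ((P.LgV : ℝ) - 1) ^ n) := by
        rw [mul_pow]; ring
    _ ≤ 6 * P.XV * P.K * (24 * Real.exp 1) ^ n * ((P.LV : ℝ) ^ n / P.g ^ (n - 1)) :=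
        mul_le_mul_of_nonneg_left hpow (by positivity)
    _ = 6 * P.XV * P.K * (24 * Real.exp 1) ^ n * (P.LV : ℝ) ^ n / P.g ^ (n - 1) := by ring
    _ ≤ _ := hR

/-- **(B1) in natural numbers**: `2 (2 XsV 0 + 1) · C(M′+n, n) · K ≤ (L₀V + 1) · ∏ (2 sideV j + 1)` whenever
`M′ + n ≤ (69/4)(n+1) LgV`; with `K = (p − 1) p^m` (`K₀ := p − 1`) this is p2's `hB1` once
`#(Icc(−X₀, X₀) ×ˢ tauSet n T₀) = (2X₀+1)·C(T₀+n, n)`. [cite: Nesterenko2003, Prop 3.9 (3.48)] -/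
theorem siegel_countV {M' : ℕ} (hM : (M' : ℝ) + n ≤ (69 / 4) * (n + 1) * P.LgV) :
    2 * (2 * P.XsV 0 + 1) * Nat.choose (M' + n) n * P.K ≤ (P.L0V + 1) * ∏ j, (2 * P.sideV j + 1) := by
  have h := P.siegel_countV_real hM
  exact_mod_cast h

/-- (B1) at the natural order bound `M′ ≤ MordV 0 0 + (n+1)(ŜG+1)`. [cite: Nesterenko2003, Prop 3.9 (3.48)] -/
theorem siegel_countV' {M' : ℕ} (hM : M' ≤ P.MordV 0 0 + (n + 1) * (P.SdG + 1)) :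
    2 * (2 * P.XsV 0 + 1) * Nat.choose (M' + n) n * P.K ≤ (P.L0V + 1) * ∏ j, (2 * P.sideV j + 1) := by
  refine P.siegel_countV ?_
  have h1 : (M' : ℝ) ≤ P.MordV 0 0 + (n + 1) * (P.SdG + 1) := by exact_mod_cast hM
  have h2 := P.MordV_T0_le
  have hn : (0 : ℝ) ≤ n := by positivity
  linarith

end PadicG3Par

end Summit.ABC.StewartYu
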